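/-
Copyright (c) 2026 the pub-hodgecm-mathlib formalisation cell (harness21).  Prover seat hodgecm-mathlib-K2E3-p31 (g3), HCML Track B, programme R90-TF
(Rogawski 1990 trace formula), section S4 = Ch. 13.1–2, base `R90-C131`; S4 dealer K2E2-plan (g8), ruling S4-R59 (2) ∕ S4-R85 (b):
«(J̃♭-Σ) ASSEMBLER OF RECORD» — Σ-2 of 2: the per-base-point ROW BUNDLE from the ★ rows, in the one-place MODEL frame.  2026-09-05.
-/
import Summits.HodgeConjecture.HodgeConjecture.Theorems.R90S4TwistedTubeJacobianOfRows       -- ★ p865316 Σ-1 (this seat): `twistedTubeJacobian_of_rows`, `exists_epsNormHom`, pins, sheet glue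
import Summits.HodgeConjecture.HodgeConjecture.Theorems.R90S4TwistedTubeQuotientWindows      -- ★ p864964 (TJ5-win, K2E3-p03): `exists_chartWindowSubgroups`, the four window letters
import Summits.HodgeConjecture.HodgeConjecture.Theorems.R90S4TwistedHerbrandWindowLetter     -- ★ p865254 (TJ6) 3d (R90-C131-p02): `twistedHerbrandWindow` = the `h♮` row
import Summits.HodgeConjecture.HodgeConjecture.Theorems.R90S4TwistedHerbrandWindowLetters    -- ★ LETTERS (R90-C131-p05): `chart_mem_iff_mem_centralizer`, `exists_antiFixed_scalar`, …
import Summits.HodgeConjecture.HodgeConjecture.Theorems.R90S4TwistedTubeModelChart            -- ★ p864971 (M-2, R90-C131-p04): `exists_tauHom`, `valBound_tau`, `continuous_tau`, `rho_eps_chart_inv_eq_cayley_tau`, `isClosedEmbedding_addMonoidHom_id`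
import Summits.HodgeConjecture.HodgeConjecture.Theorems.R90S4TwistedWeylJacobianAlgebra       -- ★ (TJ1) (K2E4-p11): `tau_mul`, `tau_one`
import HarnessLib

/-!
# R90-TF · S4 «Ch. 13.1–2» · road (J̃♭) — THE TWISTED TUBE JACOBIAN LETTER: THE ROW BUNDLE FROM THE ★ ROWS (Σ-2 of 2, one-place model frame)

Cell `hodgecm-mathlib`, crux H413 (`stmt-HodgeConjecture-24833`, lane `--supports … --as helper`), route of record `HCCMUnconditional` (no route verbs;
count-neutral).  THEOREMS ONLY (no `def`, no `instance`, no notation, no named-fact hypothesis, no `sorry`); ★-only imports, NO `Lines` import.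

Σ-1 (★ `R90S4TwistedTubeJacobianOfRows.twistedTubeJacobian_of_rows`) reduced the (J̃♭) letter (3′) of the C ED. 6 socket `stub_R90_S4_twistedTubeJacobian` to the
per-base-point ROW BUNDLE `HB` in ★ p864907's bytes.  THIS FILE BUILDS `HB` FROM THE ★ ROWS in the ONE-PLACE MODEL FRAME of ★ p865097 ∕ p865006 (`ρG : G̃_v →* GL₃(K)`
injective, `σ` an involution of `K` not increasing valuations and `≠ id`, `J` hermitian invertible integral with integral inverse, the twist read through the model
`ρG(ε g) = J⁻¹ ((ρG g)⁻¹.map σ)ᵀ J`, regular elements have separable characteristic polynomial through `ρG`) — at the datum `K := L_w`, `ρG :=` ★ `localGLPiEquiv ≫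
localGLPiEvalEquiv`, `σ := σ_w`, `J := Φ₃` (the one-place letters of K2E3-p36 (g4) ∕ K2E4-p11 (g10)'s `R90S4TwistedTubeModelGtLoc{Letters}`):
* **`twistedTubeJacobian_of_model`** — GIVEN the MODEL row as a hypothesis `Hmodel` (★ p865097 `twistedTubeJacobianLocal_model`'s ∃-export AT THE DATUM `G := G̃_v`,
  `T := T̃`, `tm := τ̃`, `Ψ := (x, b) ↦ x b ε(x)⁻¹`, `D := cartanWeight ∘ φ`, for every norm homomorphism `φ`, every Haar `τ̃` and every base point `b₀ ∈ T̃` with `N b₀`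
  regular — K2E4-p11's `twistedTubeJacobianLocal_model_gtLoc`), the pin `e : T ≃ T′` with `e_* tT = τ′` (Σ-1 `exists_pinEquiv_map_eq`) and `T′ = T̃^ε` (`hP'ε`), THE LETTER
  (3′) HOLDS at every point of the sheeted transversal: per base point `b₁ = s(t)·u` — `N b₁ = t` is regular (★ `epsNorm_sheet`); the MODEL row gives the chart
  `(α, Λ, c, σV, pM, pT, Λ′, Ξ, k)` with its letters and «W-LOC»; ★ p864964 gives the chart windows `W j = T̃ ∩ c(Λ_j)` and `hwin₂ hν hA₀m hwin₁` ON THE SAME `M₀ = c(pM Λ′ₖ)`,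
  `m₀ = (νGt∕τ̃)(π c Λ′ₖ)`; ★ p865254 gives `h♮` on the same windows, its letters discharged by ★ LETTERS (`𝔞 = Cent_K(γ)`, anti-fixed `θ`), ★ M-2 (`E := τ`,
  `hε hE hEc`) and ★ (TJ1) (`τ` anti-multiplicative, `τ 1 = 1`); then Σ-1 `twistedTubeJacobian_of_rows`.
The last step — `twistedTubeJacobian_of_record` = the socket bytes — is `twistedTubeJacobian_of_model` at `A := Cent(γ₀)`, `P′ := G̃_{δ₀ε}` (`rfl`, ★
`mem_epsCentralizer_iff_of_mem_centralizer`, ★ LETTERS `forall_mem_epsCentralizer_iff_of_comm`, Σ-1 `exists_pinEquiv_map_eq`) with `Hmodel` and the one-place letters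
supplied BY NAME from `R90S4TwistedTubeModelGtLoc{Letters}` (K2E4-p11 ∕ K2E3-p36).
HONEST LABEL: HC_CM is proved only modulo the 7 printed citations (2 remaining named inputs: hLiu418 = `stmt-HodgeConjecture-24832`, h413 =
`stmt-HodgeConjecture-24833`) until rung 0 closes.  This file pays no socket by itself: it is CONDITIONAL on the MODEL row at the datum (`Hmodel`); (J̃♭) ∕ (W-NP)
stay OPEN; REL ≠ ★ ≠ BUILT.

## References
* [Rogawski1990] J. D. Rogawski, *Automorphic Representations of Unitary Groups in Three Variables*, Ann. of Math. Stud. 123 (1990), §12.5 p. 186; §4.10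
  pp. 62–64; §3.11 Prop. 3.11.1 pp. 34–35.
* [HarishChandra1970] Harish-Chandra (notes by G. van Dijk), *Harmonic Analysis on Reductive p-adic Groups*, LNM 162 (1970), Lemma 22. Context locator.
* [DeitmarEchterhoff2014] A. Deitmar, S. Echterhoff, *Principles of Harmonic Analysis*, 2nd ed. (2014), Thm. 1.5.3. Context locator.
-/

set_option autoImplicit false
-- the mandated namespace repeats the single-problem summit's segment (`HodgeConjecture.HodgeConjecture`)
set_option linter.dupNamespace false

noncomputable section

open MeasureTheory Measure Set Filter Topology Function NumberField IsDedekindDomain Matrix ValuativeRel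
open scoped ENNReal NNReal MatrixGroups Pointwise
open Literature.MeasureTheory.Group
open Literature.NumberTheory.Rogawski1990 Literature.NumberTheory.Rogawski1990.Ch4Sec10
open Literature.NumberTheory.Automorphic Literature.NumberTheory.Automorphic.UnitaryGroup
open Literature.NumberTheory.Weil1982.UnitaryFinTopForm

namespace Summit.HodgeConjecture.HodgeConjecture.R90.S4

section JacobianOfModel

variable {L : Type} [Field L] [NumberField L] [IsCMField L] {v : HeightOneSpectrum (𝓞 ↥(maximalRealSubfield L))}

variable (L v) in
set_option maxHeartbeats 800000 in  -- one statement carrying the MODEL ∃-export (35 conjuncts) + four ★ p864964 calls + one ★ p865254 call (≈ 40 arguments each)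
/-- **THE TWISTED TUBE JACOBIAN LETTER FROM THE MODEL ROW** (Σ-2; the (J̃♭-Σ) assembly of S4-R59 (2) in the one-place MODEL frame `(ρG, σ, J)` of ★ p865097).
For the socket's data (`T = Cent_{G_v}(γ₀)`, `T̃` entered as `A` with `hAγ`, `T′` as a closed `P′ ≤ A` with `T′ = A^ε` (`hP'ε`), Haar `τ′`, `tT`, the family `Ψ`, a Borel
norm section `s` and a norm-one sheet transversal `R`), a pin `e : T ≃* P′`, continuous, with `e(t) = t` in `G̃_v` and `e_* tT = τ′`, and the MODEL ROW `Hmodel` (★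
p865097's ∃-export at `G := G̃_v, T := A, tm := τ̃, Ψ := (x,b) ↦ x b ε(x)⁻¹, D := cartanWeight ∘ φ` for every norm homomorphism `φ`, Haar `τ̃`, base point `b₀ ∈ A`
with `N b₀` regular): THE LETTER (3′) holds at every point of the sheeted transversal — the ROW BUNDLE of Σ-1 `twistedTubeJacobian_of_rows` is assembled from `Hmodel`,
★ p864964 (`W`, `hwin₂ hν hA₀m hwin₁`) and ★ p865254 (`h♮`, letters by ★ LETTERS ∕ ★ M-2 ∕ ★ (TJ1)) on ONE chart per base point.
«`dδ̃ = D_G(Nδ)² dδ` on the twisted tube.» [cite: Rogawski1990, §12.5 p. 186; §4.10 pp. 62–64] [cite: HarishChandra1970, Lemma 22] -/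
theorem twistedTubeJacobian_of_model (hv : ∀ w : PlacesOver L v, IsCMField.complexConj L • w.1 = w.1)
    [LocallyCompactSpace (GtLoc L v)] [SecondCountableTopology (GtLoc L v)] [T2Space (GtLoc L v)]
    [MeasurableSpace (Gqs L v)] [BorelSpace (Gqs L v)] [MeasurableSpace (GtLoc L v)] [BorelSpace (GtLoc L v)]
    -- the one-place MODEL frame
    {K : Type*} [Field K] [ValuativeRel K] [TopologicalSpace K] [IsNonarchimedeanLocalField K] [CharZero K] [SecondCountableTopology K] [T2Space K]
    (ρG : GtLoc L v →* GL (Fin 3) K) (hρinj : Function.Injective ρG)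
    (σ : K →+* K) (hσc : Continuous σ) (hσ2 : ∀ a, σ (σ a) = a) (hσv : ∀ x, valuation K (σ x) ≤ valuation K x) (hσne : ∃ u : K, σ u ≠ u)
    (J : Matrix (Fin 3) (Fin 3) K) (hJ : IsUnit J.det) (_hJh : (J.map σ)ᵀ = J) (hJ1 : ValBound 1 J) (hJi1 : ValBound 1 J⁻¹)
    (hερ : ∀ g : GtLoc L v, ((ρG (epsLoc L (splitFormGL L) v g) : GL (Fin 3) K) : Matrix (Fin 3) (Fin 3) K) = J⁻¹ * ((((ρG g)⁻¹ : GL (Fin 3) K) : Matrix (Fin 3) (Fin 3) K).map σ)ᵀ * J)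
    -- the socket's data
    (νGt : Measure (GtLoc L v)) [νGt.IsHaarMeasure] [νGt.IsMulRightInvariant]
    {T : Subgroup (Gqs L v)} {γ₀ : Gqs L v} (hγ₀ : IsRegularElt (γ₀.val : GtLoc L v)) (hT : T = Subgroup.centralizer ({γ₀} : Set (Gqs L v)))
    (hγsep : (((ρG γ₀.val : GL (Fin 3) K) : Matrix (Fin 3) (Fin 3) K)).charpoly.Separable)
    {A : Subgroup (GtLoc L v)} (hAγ : A = Subgroup.centralizer ({(γ₀.val : GtLoc L v)} : Set (GtLoc L v))) (hAcl : IsClosed (A : Set (GtLoc L v)))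
    (hεA : ∀ x ∈ A, epsLoc L (splitFormGL L) v x ∈ A)
    {P' : Subgroup (GtLoc L v)} (hP'cl : IsClosed (P' : Set (GtLoc L v))) (hP'A : P' ≤ A) (hP'ε : ∀ a ∈ A, a ∈ P' ↔ epsLoc L (splitFormGL L) v a = a)
    (τ' : Measure ↥P') [τ'.IsHaarMeasure] [τ'.IsInvInvariant] [MeasurableSpace (GtLoc L v ⧸ P')] [BorelSpace (GtLoc L v ⧸ P')]
    (Ψ : (GtLoc L v ⧸ P') × ↥A → GtLoc L v) (hΨ : ∀ (x : GtLoc L v) (b : ↥A), Ψ (QuotientGroup.mk x, b) = x * b * (epsLoc L (splitFormGL L) v x)⁻¹)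
    (s : ↥T → ↥A) (hsm : Measurable s) (hsN : ∀ t : ↥T, epsNorm (epsLoc L (splitFormGL L) v) (s t : GtLoc L v) = ((t : Gqs L v)).val)
    (R : Finset ↥A) (hRN : ∀ u ∈ R, epsNorm (epsLoc L (splitFormGL L) v) (u : GtLoc L v) = 1)
    (tT : Measure ↥T) [tT.IsHaarMeasure]
    -- the pin `T ≃ T′`
    (e : ↥T ≃* ↥P') (hec : Continuous e) (hev : ∀ t : ↥T, ((e t : ↥P') : GtLoc L v) = ((t : Gqs L v)).val) (hpin : Measure.map e tT = τ')
    -- THE MODEL ROW at the datum (★ p865097's ∃-export; K2E4-p11's `twistedTubeJacobianLocal_model_gtLoc`)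
    (Hmodel : ∀ (φ : ↥A →* ↥T)
        (_hφ : ∀ b : ↥A, (((φ b : ↥T) : Gqs L v).val : GtLoc L v) = epsNorm (epsLoc L (splitFormGL L) v) (b : GtLoc L v)) (_hφc : Continuous φ)
        (τA : Measure ↥A) [τA.IsMulLeftInvariant] [IsFiniteMeasureOnCompacts τA] [τA.IsOpenPosMeasure] [τA.IsInvInvariant] [SFinite τA]
        [MeasurableSpace (GtLoc L v ⧸ A)] [BorelSpace (GtLoc L v ⧸ A)]
        (b₀ : GtLoc L v) (hb₀ : b₀ ∈ A), IsRegularElt (epsNorm (epsLoc L (splitFormGL L) v) b₀) →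
      ∃ (α : ValueGroupWithZero K) (Λ : ℕ → AddSubgroup (Matrix (Fin 3) (Fin 3) K)) (c : Matrix (Fin 3) (Fin 3) K → GtLoc L v)
        (σV : Matrix (Fin 3) (Fin 3) K → Matrix (Fin 3) (Fin 3) K → Matrix (Fin 3) (Fin 3) K) (pM pT : Matrix (Fin 3) (Fin 3) K →+ Matrix (Fin 3) (Fin 3) K) (Λ' : ℕ → AddSubgroup (Matrix (Fin 3) (Fin 3) K)) (Ξ : Matrix (Fin 3) (Fin 3) K → Matrix (Fin 3) (Fin 3) K) (k : ℕ),
        α ≠ 0 ∧ α < 1 ∧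
        (∀ j X, X ∈ Λ j ↔ ValBound (α ^ (j + 1)) X) ∧
        (∀ X ∈ Λ 0, ((ρG (c X) : GL (Fin 3) K) : Matrix (Fin 3) (Fin 3) K) = cayley X) ∧
        ContinuousOn c (Λ 0 : Set (Matrix (Fin 3) (Fin 3) K)) ∧ IsOpen (c '' (Λ 0 : Set (Matrix (Fin 3) (Fin 3) K))) ∧
        (∀ W ∈ Λ 0, ∀ X ∈ Λ 0, σV W X = (1 - W)⁻¹ * (W + X) * (1 + W * X)⁻¹ * (1 - W)) ∧
        (∀ W ∈ Λ 0, ContinuousOn (σV W) (Λ 0 : Set (Matrix (Fin 3) (Fin 3) K))) ∧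
        (∀ j Z, Z ∈ Λ' j ↔ (pM Z ∈ Λ j ∧ pT Z ∈ Λ j)) ∧ (∀ Z, pM Z + pT Z = Z) ∧ (∀ Z, pM (pM Z) = pM Z) ∧ Continuous pM ∧ Continuous pT ∧
        (∀ j, ∀ Z ∈ Λ (j + k), pM Z ∈ Λ j ∧ pT Z ∈ Λ j) ∧
        (∀ Z, Ξ Z = (1 - pM Z)⁻¹ * (pM Z + pT Z) * (1 + pM Z * pT Z)⁻¹ * (1 - pM Z)) ∧
        (∀ Y ∈ Λ 0, pM Y = 0 → c Y ∈ A) ∧ (∀ W ∈ Λ 0, c W ∈ A → pM W = 0) ∧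
        (∀ j, ∀ X ∈ Λ j, epsLoc L (splitFormGL L) v (c X) ∈ c '' (Λ j : Set (Matrix (Fin 3) (Fin 3) K))) ∧
        ∃ U : Set ↥A, IsOpen U ∧ (⟨b₀, hb₀⟩ : ↥A) ∈ U ∧
          MeasurableSet (c '' (pM '' (Λ' k : Set (Matrix (Fin 3) (Fin 3) K)))) ∧
          quotientMeasure A τA hAcl νGt ((QuotientGroup.mk : GtLoc L v → GtLoc L v ⧸ A) '' (c '' (Λ' k : Set (Matrix (Fin 3) (Fin 3) K)))) ≠ 0 ∧
          quotientMeasure A τA hAcl νGt ((QuotientGroup.mk : GtLoc L v → GtLoc L v ⧸ A) '' (c '' (Λ' k : Set (Matrix (Fin 3) (Fin 3) K)))) ≠ ⊤ ∧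
          InjOn (fun p : GtLoc L v × ↥A => p.1 * (p.2 : GtLoc L v) * (epsLoc L (splitFormGL L) v p.1)⁻¹) ((c '' (pM '' (Λ' k : Set (Matrix (Fin 3) (Fin 3) K)))) ×ˢ U) ∧
          ∀ V' : Set ↥A, MeasurableSet V' → V' ⊆ U →
            νGt ((fun p : GtLoc L v × ↥A => p.1 * (p.2 : GtLoc L v) * (epsLoc L (splitFormGL L) v p.1)⁻¹) '' ((c '' (pM '' (Λ' k : Set (Matrix (Fin 3) (Fin 3) K)))) ×ˢ V')) =
              quotientMeasure A τA hAcl νGt ((QuotientGroup.mk : GtLoc L v → GtLoc L v ⧸ A) '' (c '' (Λ' k : Set (Matrix (Fin 3) (Fin 3) K)))) * ∫⁻ b in V', ((cartanWeight L v T (φ b) : ℝ≥0) : ℝ≥0∞) ∂τA) :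
    ∀ b₁ ∈ {b : ↥A | ∃ t : ↥T, IsRegularElt (((t : Gqs L v)).val : GtLoc L v) ∧ ∃ u ∈ R, b = s t * u},
      ∃ U' : Set ↥A, IsOpen U' ∧ b₁ ∈ U' ∧
      ∃ A₀ : Set (GtLoc L v ⧸ P'), MeasurableSet A₀ ∧ quotientMeasure P' τ' hP'cl νGt A₀ ≠ 0 ∧ quotientMeasure P' τ' hP'cl νGt A₀ ≠ ⊤ ∧
        ∀ u ∈ R, ∀ V : Set ↥T, MeasurableSet V → V ⊆ {t : ↥T | IsRegularElt (((t : Gqs L v)).val : GtLoc L v)} → (fun t : ↥T => s t * u) '' V ⊆ U' →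
          νGt (Ψ '' (A₀ ×ˢ ((fun t : ↥T => s t * u) '' V))) = quotientMeasure P' τ' hP'cl νGt A₀ * ∫⁻ t in V, (cartanWeight L v T t : ℝ≥0∞) ∂tT := by
  refine twistedTubeJacobian_of_rows L v hv νGt hγ₀ hT hAγ hεA hP'cl hP'A τ' Ψ hΨ s hsm hsN R hRN tT ?_
  intro φ hφ τA _ _ _ ρK _ _ b₁ hb₁
  have hΦ := splitFormGL_isHermitian L
  subst hAγ
  -- ### frame facts
  haveI : IsClosed ((Subgroup.centralizer ({(γ₀.val : GtLoc L v)} : Set (GtLoc L v))) : Set (GtLoc L v)) := hAcl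
  haveI : IsClosed (P' : Set (GtLoc L v)) := hP'cl
  have hAc : ∀ x ∈ Subgroup.centralizer ({(γ₀.val : GtLoc L v)} : Set (GtLoc L v)), ∀ y ∈ Subgroup.centralizer ({(γ₀.val : GtLoc L v)} : Set (GtLoc L v)),
      x * y = y * x := fun x hx y hy => mul_comm_of_mem_centralizer_of_isRegularElt hγ₀ hx hy
  have hεc : Continuous (epsLoc L (splitFormGL L) v) := continuous_epsLoc L (splitFormGL L) v
  have hε2 : ∀ δ : GtLoc L v, epsLoc L (splitFormGL L) v (epsLoc L (splitFormGL L) v δ) = δ := fun δ => twistLocal_twistLocal_cm L 3 (splitFormGL L) hΦ v δ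
  have hεε : ∀ x ∈ Subgroup.centralizer ({(γ₀.val : GtLoc L v)} : Set (GtLoc L v)), epsLoc L (splitFormGL L) v (epsLoc L (splitFormGL L) v x) = x := fun x _ => hε2 x
  have h2 : (2 : K) ≠ 0 := two_ne_zero
  haveI : LocallyCompactSpace ↥(Subgroup.centralizer ({(γ₀.val : GtLoc L v)} : Set (GtLoc L v))) := hAcl.locallyCompactSpace
  haveI : LocallyCompactSpace ↥P' := hP'cl.locallyCompactSpace
  haveI : SigmaCompactSpace ↥(Subgroup.centralizer ({(γ₀.val : GtLoc L v)} : Set (GtLoc L v))) := sigmaCompactSpace_of_locallyCompact_secondCountable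
  haveI : SigmaFinite τA := IsHaarMeasure.sigmaFinite τA
  haveI : SFinite τA := instSFiniteOfSigmaFinite
  haveI : SigmaCompactSpace ↥P' := sigmaCompactSpace_of_locallyCompact_secondCountable
  haveI : SigmaFinite τ' := IsHaarMeasure.sigmaFinite τ'
  haveI : SFinite τ' := instSFiniteOfSigmaFinite
  letI : MeasurableSpace (GtLoc L v ⧸ Subgroup.centralizer ({(γ₀.val : GtLoc L v)} : Set (GtLoc L v))) := borel _
  haveI : BorelSpace (GtLoc L v ⧸ Subgroup.centralizer ({(γ₀.val : GtLoc L v)} : Set (GtLoc L v))) := ⟨rfl⟩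
  -- ### the norm homomorphism `φ`: continuity, surjectivity, `ε`-invariance through the pin
  have hφc : Continuous φ := by
    have h1 : Continuous fun b : ↥(Subgroup.centralizer ({(γ₀.val : GtLoc L v)} : Set (GtLoc L v))) => epsNorm (epsLoc L (splitFormGL L) v) (b : GtLoc L v) :=
      continuous_subtype_val.mul (hεc.comp continuous_subtype_val)
    have h2' : Continuous fun b : ↥(Subgroup.centralizer ({(γ₀.val : GtLoc L v)} : Set (GtLoc L v))) => (((φ b : ↥T) : Gqs L v).val : GtLoc L v) := by
      simp_rw [hφ]; exact h1
    exact continuous_induced_rng.2 (continuous_induced_rng.2 h2')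
  have hφs : Function.Surjective φ := by
    intro t
    have ht : (t : Gqs L v) ∈ Subgroup.centralizer ({γ₀} : Set (Gqs L v)) := hT ▸ t.2
    obtain ⟨δ, hδ, hN⟩ := exists_mem_centralizer_epsNorm_eq L (splitFormGL L) v γ₀ ht
    exact ⟨⟨δ, hδ⟩, Subtype.ext (Subtype.ext (by rw [hφ]; exact hN))⟩
  have hφe : ∀ w : ↥(Subgroup.centralizer ({(γ₀.val : GtLoc L v)} : Set (GtLoc L v))), ((e (φ w) : ↥P') : GtLoc L v) = (w : GtLoc L v) * epsLoc L (splitFormGL L) v w :=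
    fun w => by rw [hev, hφ]; rfl
  -- ### the base point: `N b₁ = t` is regular
  obtain ⟨t, htreg, u, hu, rfl⟩ := hb₁
  have hreg : IsRegularElt (epsNorm (epsLoc L (splitFormGL L) v) ((s t * u : ↥(Subgroup.centralizer ({(γ₀.val : GtLoc L v)} : Set (GtLoc L v)))) : GtLoc L v)) := by
    rw [epsNorm_sheet hγ₀ s hsN R hRN t u hu]; exact htreg
  -- ### THE MODEL ROW at `b₁`
  obtain ⟨α, Λ, c, σV, pM, pT, Λ', Ξ, k, hα, hα1, hΛ, hc, hcc, hK0, hσV, hσVc, hΛ', hsum, hidem, hpMc, hpTc, hshift, hΞ, hcT, hTc, hεwin,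
      U, hUo, hb₀U, hM₀m, hne0, hnet, -, hloc⟩ :=
    Hmodel φ hφ hφc τA (s t * u : ↥(Subgroup.centralizer ({(γ₀.val : GtLoc L v)} : Set (GtLoc L v)))).1 (s t * u).2 hreg
  -- ### THE CHART WINDOWS (★ p864964) at `ι := id`
  have hι : IsClosedEmbedding ⇑(AddMonoidHom.id (Matrix (Fin 3) (Fin 3) K)) := IsClosedEmbedding.id
  have hΛι : ∀ j X, X ∈ Λ j ↔ ValBound (α ^ (j + 1)) ((AddMonoidHom.id (Matrix (Fin 3) (Fin 3) K)) X) := hΛ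
  have hcι : ∀ X ∈ Λ 0, ((ρG (c X) : GL (Fin 3) K) : Matrix (Fin 3) (Fin 3) K) = cayley ((AddMonoidHom.id (Matrix (Fin 3) (Fin 3) K)) X) := hc
  have hσι : ∀ W ∈ Λ 0, ∀ X ∈ Λ 0, (AddMonoidHom.id (Matrix (Fin 3) (Fin 3) K)) (σV W X) =
      (1 - (AddMonoidHom.id (Matrix (Fin 3) (Fin 3) K)) W)⁻¹ * ((AddMonoidHom.id (Matrix (Fin 3) (Fin 3) K)) W + (AddMonoidHom.id (Matrix (Fin 3) (Fin 3) K)) X) *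
        (1 + (AddMonoidHom.id (Matrix (Fin 3) (Fin 3) K)) W * (AddMonoidHom.id (Matrix (Fin 3) (Fin 3) K)) X)⁻¹ * (1 - (AddMonoidHom.id (Matrix (Fin 3) (Fin 3) K)) W) := hσV
  have hΞι : ∀ Z ∈ Λ' k, (AddMonoidHom.id (Matrix (Fin 3) (Fin 3) K)) (Ξ Z) =
      (1 - (AddMonoidHom.id (Matrix (Fin 3) (Fin 3) K)) (pM Z))⁻¹ * ((AddMonoidHom.id (Matrix (Fin 3) (Fin 3) K)) (pM Z) + (AddMonoidHom.id (Matrix (Fin 3) (Fin 3) K)) (pT Z)) *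
        (1 + (AddMonoidHom.id (Matrix (Fin 3) (Fin 3) K)) (pM Z) * (AddMonoidHom.id (Matrix (Fin 3) (Fin 3) K)) (pT Z))⁻¹ * (1 - (AddMonoidHom.id (Matrix (Fin 3) (Fin 3) K)) (pM Z)) := fun Z _ => hΞ Z
  obtain ⟨W, hW, hWo, hWc, hWanti, hWb⟩ := exists_chartWindowSubgroups (AddMonoidHom.id (Matrix (Fin 3) (Fin 3) K)) Λ ρG c σV
    (Subgroup.centralizer ({(γ₀.val : GtLoc L v)} : Set (GtLoc L v))) hAcl hι hΛι hα hα1 h2 hρinj hcι hcc hK0 hσι hσVc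
  have hWε : ∀ (j : ℕ) (w : ↥(Subgroup.centralizer ({(γ₀.val : GtLoc L v)} : Set (GtLoc L v)))), w ∈ W j →
      (⟨epsLoc L (splitFormGL L) v w, hεA w w.2⟩ : ↥(Subgroup.centralizer ({(γ₀.val : GtLoc L v)} : Set (GtLoc L v)))) ∈ W j := by
    intro j w hw
    have hw' : (w : GtLoc L v) ∈ c '' (Λ j : Set (Matrix (Fin 3) (Fin 3) K)) := by
      have h := (Set.ext_iff.1 (hW j) w).1 hw
      exact h
    obtain ⟨X, hX, hXw⟩ := hw'
    have h' : epsLoc L (splitFormGL L) v (w : GtLoc L v) ∈ c '' (Λ j : Set (Matrix (Fin 3) (Fin 3) K)) := by rw [← hXw]; exact hεwin j X hX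
    exact (Set.ext_iff.1 (hW j) ⟨epsLoc L (splitFormGL L) v w, hεA w w.2⟩).2 h'
  -- ### the four window letters (★ p864964) on the SAME transversal `c(pM Λ′ₖ)` and mass
  have hwin₂ := fun j (hj : k ≤ j) => measure_transversal_mul_window_eq (AddMonoidHom.id (Matrix (Fin 3) (Fin 3) K)) Λ ρG c σV pM pT Ξ
    (Subgroup.centralizer ({(γ₀.val : GtLoc L v)} : Set (GtLoc L v))) νGt τA hAcl hι hΛι hα hα1 h2 hρinj hcι hcc hK0 hσι hσVc hΛ' hsum hidem hpMc hpTc hshift hΞι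
    hcT hTc (hW j) hj
  have hν := fun j (hj : k ≤ j) => measure_transversal_mul_window_ne (AddMonoidHom.id (Matrix (Fin 3) (Fin 3) K)) Λ ρG c pM pT Ξ
    (Subgroup.centralizer ({(γ₀.val : GtLoc L v)} : Set (GtLoc L v))) νGt hι hΛι hα hα1 h2 hρinj hcι hcc hK0 hΛ' hsum hidem hpMc hpTc hshift hΞι hcT hTc (hW j) hj
  have hA₀m := fun j (hj : k ≤ j) => measurableSet_image_mk_transversal_mul_window (AddMonoidHom.id (Matrix (Fin 3) (Fin 3) K)) Λ ρG c pM pT Ξ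
    (Subgroup.centralizer ({(γ₀.val : GtLoc L v)} : Set (GtLoc L v))) P' hι hΛι hα hα1 h2 hρinj hcι hcc hK0 hΛ' hsum hidem hpMc hpTc hshift hΞι hcT hTc (hW j) hj
  have hwin₁ := fun j (hj : k ≤ j) => measure_transversal_mul_window_eq_quotient_mul (AddMonoidHom.id (Matrix (Fin 3) (Fin 3) K)) Λ ρG c σV pM pT Ξ
    (Subgroup.centralizer ({(γ₀.val : GtLoc L v)} : Set (GtLoc L v))) P' νGt τ' hP'cl hP'A hι hΛι hα hα1 h2 hρinj hcι hcc hK0 hσι hσVc hΛ' hsum hidem hpMc hpTc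
    hshift hΞι hcT hTc (hW j) hj
  -- ### the Herbrand window letter `h♮` (★ p865254), its letters at the model
  have hc' : ∀ X, ValBound α X → ((ρG (c X) : GL (Fin 3) K) : Matrix (Fin 3) (Fin 3) K) = cayley X := forall_valBound_of_forall_mem_level_zero hΛ hc
  have hW' : ∀ (j : ℕ) (a : ↥(Subgroup.centralizer ({(γ₀.val : GtLoc L v)} : Set (GtLoc L v)))), a ∈ W j ↔ ∃ X, ValBound (α ^ (j + 1)) X ∧ c X = a := by
    intro j a
    rw [← SetLike.mem_coe, hW j]
    simp only [Set.mem_setOf_eq, Set.mem_image, SetLike.mem_coe, hΛ]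
  have hTρ : ∀ g, g ∈ Subgroup.centralizer ({(γ₀.val : GtLoc L v)} : Set (GtLoc L v)) ↔ ρG g * ρG γ₀.val = ρG γ₀.val * ρG g := by
    intro g
    rw [Subgroup.mem_centralizer_iff]
    simp only [Set.mem_singleton_iff, forall_eq]
    constructor
    · intro h
      have h' := congrArg ρG h
      rwa [map_mul, map_mul, eq_comm] at h'
    · intro h
      apply hρinj
      rw [map_mul, map_mul]
      exact h.symm
  have h𝔞 := chart_mem_iff_mem_centralizer ρG hTρ c hα1 h2 hc'
  have h𝔞c := centralizer_comm_of_charpoly_separable hγsep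
  have h𝔞i := inv_mem_centralizer_of_isUnit (γ := ((ρG γ₀.val : GL (Fin 3) K) : Matrix (Fin 3) (Fin 3) K))
  have h𝔞cl := isClosed_centralizer_matrix (γ := ((ρG γ₀.val : GL (Fin 3) K) : Matrix (Fin 3) (Fin 3) K))
  obtain ⟨E, hEdef⟩ := exists_tauHom σ J
  have hEm : ∀ X Y, E (X * Y) = E Y * E X := fun X Y => by rw [hEdef, hEdef, hEdef]; exact tau_mul σ J hJ X Y
  have hE1 : E 1 = 1 := by rw [hEdef]; exact tau_one σ J hJ
  have hEc : Continuous E := by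
    have h := continuous_tau σ J hσc
    exact h.congr fun W => (hEdef W).symm
  have hE : ∀ (γ : ValueGroupWithZero K) (X : Matrix (Fin 3) (Fin 3) K), ValBound γ X → ValBound γ (E X) := fun γ X hX => by
    rw [hEdef]; exact valBound_tau σ J hσv hJ1 hJi1 hX
  have hε' : ∀ X, ValBound α X → (((ρG (epsLoc L (splitFormGL L) v (c X)))⁻¹ : GL (Fin 3) K) : Matrix (Fin 3) (Fin 3) K) = cayley (E X) := by
    intro X hX
    rw [hEdef]
    exact forall_valBound_of_forall_mem_level_zero hΛ (rho_eps_chart_inv_eq_cayley_tau σ J ρG hJ hσv hJ1 hJi1 (epsLoc L (splitFormGL L) v) hερ hΛ hα1 c hc) X hX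
  obtain ⟨θ, hθ0, hθ1, hθσ⟩ := exists_antiFixed_scalar σ hσ2 hσne
  have hEθ : ∀ X, E (θ • X) = -(θ • E X) := fun X => by rw [hEdef, hEdef]; exact tau_smul_of_antiFixed σ J hθσ X
  have hnat := twistedHerbrandWindow (epsLoc L (splitFormGL L) v) (Subgroup.centralizer ({(γ₀.val : GtLoc L v)} : Set (GtLoc L v))) P' φ hP'A hAc hεA hεε hεc hP'ε hφc hφs
    e hec hφe ρK τ' tT hpin W hWo hWc hWε ρG hρinj c hα hα1 h2 hc' hW'
    (Subalgebra.centralizer K ({((ρG γ₀.val : GL (Fin 3) K) : Matrix (Fin 3) (Fin 3) K)} : Set (Matrix (Fin 3) (Fin 3) K))) h𝔞c h𝔞i h𝔞cl h𝔞 E hEm hE1 hEc hE hε' hθ0 hθ1 hEθ (j₀ := k)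
  -- ### THE ROW BUNDLE
  exact ⟨W, _, _, k, U, fun b => cartanWeight L v T (φ b),
    hWo, hWc, hWanti, hWb, hWε, hA₀m, hν, hwin₁, hwin₂, hUo.mem_nhds hb₀U, fun _ _ => rfl, hloc, hnat⟩


variable (L v) in
set_option maxHeartbeats 800000 in  -- the socket bytes + the MODEL ∃-export at the literal datum
/-- **THE (J̃♭) SOCKET LETTER FROM THE MODEL ROW AT THE DATUM** — the C ED. 6 socket `stub_R90_S4_twistedTubeJacobian` VERBATIM (typ1 (g2) v3 :85–:118 without `hTc`;
`GLoc` spelled `Gqs`), with the one-place MODEL frame `(K, ρG, σ, J)` and the MODEL ROW `Hmodel` (★ p865097's ∃-export at `T̃ = Cent_{G̃_v}(γ₀)`) as the only extra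
binders: `twistedTubeJacobian_of_model` at `A := Cent(γ₀)`, `P′ := G̃_{δ₀ε}` — `T′ ≤ T̃` and `T′ = T̃^ε` by ★ `mem_epsCentralizer_iff_of_mem_centralizer` ∕ ★ LETTERS
`forall_mem_epsCentralizer_iff_of_comm`, the pin by Σ-1 `exists_pinEquiv_map_eq` (from the two `compactCore` pins `h1`, `htc`).  The payer of record
`twistedTubeJacobian_of_record` is THIS theorem at `K := L_w` with `(ρG, σ, J)`-letters and `Hmodel` BY NAME (`R90S4TwistedTubeModelGtLoc{Letters}`).
[cite: Rogawski1990, §12.5 p. 186; §4.10 pp. 62–64] [cite: HarishChandra1970, Lemma 22] -/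
theorem twistedTubeJacobian_of_record_of_bridge (hv : ∀ w : PlacesOver L v, IsCMField.complexConj L • w.1 = w.1)
    [LocallyCompactSpace (GtLoc L v)] [SecondCountableTopology (GtLoc L v)] [T2Space (GtLoc L v)]
    {K : Type*} [Field K] [ValuativeRel K] [TopologicalSpace K] [IsNonarchimedeanLocalField K] [CharZero K] [SecondCountableTopology K] [T2Space K]
    (ρG : GtLoc L v →* GL (Fin 3) K) (hρinj : Function.Injective ρG)
    (σ : K →+* K) (hσc : Continuous σ) (hσ2 : ∀ a, σ (σ a) = a) (hσv : ∀ x, valuation K (σ x) ≤ valuation K x) (hσne : ∃ u : K, σ u ≠ u)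
    (J : Matrix (Fin 3) (Fin 3) K) (hJ : IsUnit J.det) (hJh : (J.map σ)ᵀ = J) (hJ1 : ValBound 1 J) (hJi1 : ValBound 1 J⁻¹)
    (hερ : ∀ g : GtLoc L v, ((ρG (epsLoc L (splitFormGL L) v g) : GL (Fin 3) K) : Matrix (Fin 3) (Fin 3) K) = J⁻¹ * ((((ρG g)⁻¹ : GL (Fin 3) K) : Matrix (Fin 3) (Fin 3) K).map σ)ᵀ * J)
    (hsep : ∀ g : GtLoc L v, IsRegularElt g → (((ρG g : GL (Fin 3) K) : Matrix (Fin 3) (Fin 3) K)).charpoly.Separable) :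
    letI : MeasurableSpace (Gqs L v) := borel _
    letI : MeasurableSpace (GtLoc L v) := borel _
    letI : ∀ δ : GtLoc L v, MeasurableSpace (GtLoc L v ⧸ epsCentralizer (epsLoc L (splitFormGL L) v) δ) := fun _ => borel _
    haveI : BorelSpace (Gqs L v) := ⟨rfl⟩
    haveI : BorelSpace (GtLoc L v) := ⟨rfl⟩
    haveI : ∀ δ : GtLoc L v, BorelSpace (GtLoc L v ⧸ epsCentralizer (epsLoc L (splitFormGL L) v) δ) := fun _ => ⟨rfl⟩
    ∀ (νGt : Measure (GtLoc L v)) [νGt.IsHaarMeasure] [νGt.IsMulRightInvariant]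
      (T : Subgroup (Gqs L v)) (γ₀ : Gqs L v) (hγ₀ : IsRegularElt (γ₀.val : GtLoc L v))
      (hT : T = Subgroup.centralizer ({γ₀} : Set (Gqs L v)))
      ⦃δ₀ : GtLoc L v⦄ (hδ₀T : δ₀ ∈ Subgroup.centralizer ({(γ₀.val : GtLoc L v)} : Set (GtLoc L v))) (hδ₀reg : IsEpsRegularAt L (splitFormGL L) v δ₀)
      (τ' : Measure ↥(epsCentralizer (epsLoc L (splitFormGL L) v) δ₀)) [τ'.IsHaarMeasure] [τ'.IsInvInvariant]
      (h1 : τ' (compactCore ↥(epsCentralizer (epsLoc L (splitFormGL L) v) δ₀)) = 1)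
      (Ψ : (GtLoc L v ⧸ epsCentralizer (epsLoc L (splitFormGL L) v) δ₀) × ↥(Subgroup.centralizer ({(γ₀.val : GtLoc L v)} : Set (GtLoc L v))) → GtLoc L v)
      (hΨ : ∀ (x : GtLoc L v) (b : ↥(Subgroup.centralizer ({(γ₀.val : GtLoc L v)} : Set (GtLoc L v)))), Ψ (QuotientGroup.mk x, b) = x * b * (epsLoc L (splitFormGL L) v x)⁻¹)
      (N' : Subgroup (GtLoc L v))
      (_hN' : ∀ m, m ∈ N' ↔ m ∈ Subgroup.normalizer ((Subgroup.centralizer ({(γ₀.val : GtLoc L v)} : Set (GtLoc L v))) : Set (GtLoc L v)) ∧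
        m * (epsLoc L (splitFormGL L) v m)⁻¹ ∈ Subgroup.centralizer ({(γ₀.val : GtLoc L v)} : Set (GtLoc L v)))
      (s : ↥T → ↥(Subgroup.centralizer ({(γ₀.val : GtLoc L v)} : Set (GtLoc L v)))) (hsm : Measurable s)
      (hsN : ∀ t : ↥T, epsNorm (epsLoc L (splitFormGL L) v) (s t : GtLoc L v) = ((t : Gqs L v)).val)
      (R : Finset ↥(Subgroup.centralizer ({(γ₀.val : GtLoc L v)} : Set (GtLoc L v))))
      (hRN : ∀ u ∈ R, epsNorm (epsLoc L (splitFormGL L) v) (u : GtLoc L v) = 1)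
      (_hRcov : ∀ w : ↥(Subgroup.centralizer ({(γ₀.val : GtLoc L v)} : Set (GtLoc L v))), epsNorm (epsLoc L (splitFormGL L) v) (w : GtLoc L v) = 1 →
        ∃ u ∈ R, ∃ a : ↥(Subgroup.centralizer ({(γ₀.val : GtLoc L v)} : Set (GtLoc L v))), (w : GtLoc L v) = u * (a * (epsLoc L (splitFormGL L) v a)⁻¹))
      (_hRinj : ∀ u ∈ R, ∀ u' ∈ R, (∃ a : ↥(Subgroup.centralizer ({(γ₀.val : GtLoc L v)} : Set (GtLoc L v))),
        ((u' : ↥(Subgroup.centralizer ({(γ₀.val : GtLoc L v)} : Set (GtLoc L v)))) : GtLoc L v) = u * (a * (epsLoc L (splitFormGL L) v a)⁻¹)) → u = u')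
      (tT : Measure ↥T) [tT.IsHaarMeasure] [tT.IsInvInvariant] (htc : tT (compactCore ↥T) = 1)
      (Hmodel : ∀ (φ : ↥(Subgroup.centralizer ({(γ₀.val : GtLoc L v)} : Set (GtLoc L v))) →* ↥T)
          (_hφ : ∀ b : ↥(Subgroup.centralizer ({(γ₀.val : GtLoc L v)} : Set (GtLoc L v))), (((φ b : ↥T) : Gqs L v).val : GtLoc L v) = epsNorm (epsLoc L (splitFormGL L) v) (b : GtLoc L v)) (_hφc : Continuous φ)
          (τA : Measure ↥(Subgroup.centralizer ({(γ₀.val : GtLoc L v)} : Set (GtLoc L v)))) [τA.IsMulLeftInvariant] [IsFiniteMeasureOnCompacts τA] [τA.IsOpenPosMeasure] [τA.IsInvInvariant] [SFinite τA]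
          [MeasurableSpace (GtLoc L v ⧸ (Subgroup.centralizer ({(γ₀.val : GtLoc L v)} : Set (GtLoc L v))))] [BorelSpace (GtLoc L v ⧸ (Subgroup.centralizer ({(γ₀.val : GtLoc L v)} : Set (GtLoc L v))))]
          (b₀ : GtLoc L v) (hb₀ : b₀ ∈ (Subgroup.centralizer ({(γ₀.val : GtLoc L v)} : Set (GtLoc L v)))), IsRegularElt (epsNorm (epsLoc L (splitFormGL L) v) b₀) →
        ∃ (α : ValueGroupWithZero K) (Λ : ℕ → AddSubgroup (Matrix (Fin 3) (Fin 3) K)) (c : Matrix (Fin 3) (Fin 3) K → GtLoc L v)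
          (σV : Matrix (Fin 3) (Fin 3) K → Matrix (Fin 3) (Fin 3) K → Matrix (Fin 3) (Fin 3) K) (pM pT : Matrix (Fin 3) (Fin 3) K →+ Matrix (Fin 3) (Fin 3) K) (Λ' : ℕ → AddSubgroup (Matrix (Fin 3) (Fin 3) K)) (Ξ : Matrix (Fin 3) (Fin 3) K → Matrix (Fin 3) (Fin 3) K) (k : ℕ),
          α ≠ 0 ∧ α < 1 ∧
          (∀ j X, X ∈ Λ j ↔ ValBound (α ^ (j + 1)) X) ∧
          (∀ X ∈ Λ 0, ((ρG (c X) : GL (Fin 3) K) : Matrix (Fin 3) (Fin 3) K) = cayley X) ∧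
          ContinuousOn c (Λ 0 : Set (Matrix (Fin 3) (Fin 3) K)) ∧ IsOpen (c '' (Λ 0 : Set (Matrix (Fin 3) (Fin 3) K))) ∧
          (∀ W ∈ Λ 0, ∀ X ∈ Λ 0, σV W X = (1 - W)⁻¹ * (W + X) * (1 + W * X)⁻¹ * (1 - W)) ∧
          (∀ W ∈ Λ 0, ContinuousOn (σV W) (Λ 0 : Set (Matrix (Fin 3) (Fin 3) K))) ∧
          (∀ j Z, Z ∈ Λ' j ↔ (pM Z ∈ Λ j ∧ pT Z ∈ Λ j)) ∧ (∀ Z, pM Z + pT Z = Z) ∧ (∀ Z, pM (pM Z) = pM Z) ∧ Continuous pM ∧ Continuous pT ∧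
          (∀ j, ∀ Z ∈ Λ (j + k), pM Z ∈ Λ j ∧ pT Z ∈ Λ j) ∧
          (∀ Z, Ξ Z = (1 - pM Z)⁻¹ * (pM Z + pT Z) * (1 + pM Z * pT Z)⁻¹ * (1 - pM Z)) ∧
          (∀ Y ∈ Λ 0, pM Y = 0 → c Y ∈ (Subgroup.centralizer ({(γ₀.val : GtLoc L v)} : Set (GtLoc L v)))) ∧ (∀ W ∈ Λ 0, c W ∈ (Subgroup.centralizer ({(γ₀.val : GtLoc L v)} : Set (GtLoc L v))) → pM W = 0) ∧
          (∀ j, ∀ X ∈ Λ j, epsLoc L (splitFormGL L) v (c X) ∈ c '' (Λ j : Set (Matrix (Fin 3) (Fin 3) K))) ∧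
          ∃ U : Set ↥(Subgroup.centralizer ({(γ₀.val : GtLoc L v)} : Set (GtLoc L v))), IsOpen U ∧ (⟨b₀, hb₀⟩ : ↥(Subgroup.centralizer ({(γ₀.val : GtLoc L v)} : Set (GtLoc L v)))) ∈ U ∧
            MeasurableSet (c '' (pM '' (Λ' k : Set (Matrix (Fin 3) (Fin 3) K)))) ∧
            quotientMeasure (Subgroup.centralizer ({(γ₀.val : GtLoc L v)} : Set (GtLoc L v))) τA (Set.isClosed_centralizer ({(γ₀.val : GtLoc L v)} : Set (GtLoc L v))) νGt ((QuotientGroup.mk : GtLoc L v → GtLoc L v ⧸ (Subgroup.centralizer ({(γ₀.val : GtLoc L v)} : Set (GtLoc L v)))) '' (c '' (Λ' k : Set (Matrix (Fin 3) (Fin 3) K)))) ≠ 0 ∧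
            quotientMeasure (Subgroup.centralizer ({(γ₀.val : GtLoc L v)} : Set (GtLoc L v))) τA (Set.isClosed_centralizer ({(γ₀.val : GtLoc L v)} : Set (GtLoc L v))) νGt ((QuotientGroup.mk : GtLoc L v → GtLoc L v ⧸ (Subgroup.centralizer ({(γ₀.val : GtLoc L v)} : Set (GtLoc L v)))) '' (c '' (Λ' k : Set (Matrix (Fin 3) (Fin 3) K)))) ≠ ⊤ ∧
            InjOn (fun p : GtLoc L v × ↥(Subgroup.centralizer ({(γ₀.val : GtLoc L v)} : Set (GtLoc L v))) => p.1 * (p.2 : GtLoc L v) * (epsLoc L (splitFormGL L) v p.1)⁻¹) ((c '' (pM '' (Λ' k : Set (Matrix (Fin 3) (Fin 3) K)))) ×ˢ U) ∧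
            ∀ V' : Set ↥(Subgroup.centralizer ({(γ₀.val : GtLoc L v)} : Set (GtLoc L v))), MeasurableSet V' → V' ⊆ U →
              νGt ((fun p : GtLoc L v × ↥(Subgroup.centralizer ({(γ₀.val : GtLoc L v)} : Set (GtLoc L v))) => p.1 * (p.2 : GtLoc L v) * (epsLoc L (splitFormGL L) v p.1)⁻¹) '' ((c '' (pM '' (Λ' k : Set (Matrix (Fin 3) (Fin 3) K)))) ×ˢ V')) =
                quotientMeasure (Subgroup.centralizer ({(γ₀.val : GtLoc L v)} : Set (GtLoc L v))) τA (Set.isClosed_centralizer ({(γ₀.val : GtLoc L v)} : Set (GtLoc L v))) νGt ((QuotientGroup.mk : GtLoc L v → GtLoc L v ⧸ (Subgroup.centralizer ({(γ₀.val : GtLoc L v)} : Set (GtLoc L v)))) '' (c '' (Λ' k : Set (Matrix (Fin 3) (Fin 3) K)))) * ∫⁻ b in V', ((cartanWeight L v T (φ b) : ℝ≥0) : ℝ≥0∞) ∂τA),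
      ∀ b₁ ∈ {b : ↥(Subgroup.centralizer ({(γ₀.val : GtLoc L v)} : Set (GtLoc L v))) | ∃ t : ↥T, IsRegularElt (((t : Gqs L v)).val : GtLoc L v) ∧ ∃ u ∈ R, b = s t * u},
        ∃ U' : Set ↥(Subgroup.centralizer ({(γ₀.val : GtLoc L v)} : Set (GtLoc L v))), IsOpen U' ∧ b₁ ∈ U' ∧
        ∃ A₀ : Set (GtLoc L v ⧸ epsCentralizer (epsLoc L (splitFormGL L) v) δ₀), MeasurableSet A₀ ∧ (quotientMeasure (epsCentralizer (epsLoc L (splitFormGL L) v) δ₀) τ' (isClosed_epsCentralizer L (splitFormGL L) v δ₀) νGt) A₀ ≠ 0 ∧ (quotientMeasure (epsCentralizer (epsLoc L (splitFormGL L) v) δ₀) τ' (isClosed_epsCentralizer L (splitFormGL L) v δ₀) νGt) A₀ ≠ ⊤ ∧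
          ∀ u ∈ R, ∀ V : Set ↥T, MeasurableSet V → V ⊆ {t : ↥T | IsRegularElt (((t : Gqs L v)).val : GtLoc L v)} → (fun t : ↥T => s t * u) '' V ⊆ U' →
            νGt (Ψ '' (A₀ ×ˢ ((fun t : ↥T => s t * u) '' V))) = (quotientMeasure (epsCentralizer (epsLoc L (splitFormGL L) v) δ₀) τ' (isClosed_epsCentralizer L (splitFormGL L) v δ₀) νGt) A₀ * ∫⁻ t in V, (cartanWeight L v T t : ℝ≥0∞) ∂tT := by
  intro νGt _ _ T γ₀ hγ₀ hT δ₀ hδ₀T hδ₀reg τ' _ _ h1 Ψ hΨ N' _ s hsm hsN R hRN _ _ tT _ _ htc Hmodel b₁ hb₁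
  letI : MeasurableSpace (Gqs L v) := borel _
  letI : MeasurableSpace (GtLoc L v) := borel _
  letI : ∀ δ : GtLoc L v, MeasurableSpace (GtLoc L v ⧸ epsCentralizer (epsLoc L (splitFormGL L) v) δ) := fun _ => borel _
  haveI : BorelSpace (Gqs L v) := ⟨rfl⟩
  haveI : BorelSpace (GtLoc L v) := ⟨rfl⟩
  haveI : ∀ δ : GtLoc L v, BorelSpace (GtLoc L v ⧸ epsCentralizer (epsLoc L (splitFormGL L) v) δ) := fun _ => ⟨rfl⟩
  have hΦ := splitFormGL_isHermitian L
  have hP'A : (epsCentralizer (epsLoc L (splitFormGL L) v) δ₀) ≤ (Subgroup.centralizer ({(γ₀.val : GtLoc L v)} : Set (GtLoc L v))) := fun g hg =>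
    ((mem_epsCentralizer_iff_of_mem_centralizer hΦ hγ₀ hδ₀T hδ₀reg g).1 hg).2
  have hAc : ∀ x ∈ (Subgroup.centralizer ({(γ₀.val : GtLoc L v)} : Set (GtLoc L v))), ∀ y ∈ (Subgroup.centralizer ({(γ₀.val : GtLoc L v)} : Set (GtLoc L v))), x * y = y * x :=
    fun x hx y hy => mul_comm_of_mem_centralizer_of_isRegularElt hγ₀ hx hy
  have hP'ε : ∀ a ∈ (Subgroup.centralizer ({(γ₀.val : GtLoc L v)} : Set (GtLoc L v))), a ∈ (epsCentralizer (epsLoc L (splitFormGL L) v) δ₀) ↔ epsLoc L (splitFormGL L) v a = a :=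
    forall_mem_epsCentralizer_iff_of_comm (epsLoc L (splitFormGL L) v) hAc hδ₀T
  obtain ⟨e, hev, hpin⟩ := exists_pinEquiv_map_eq hγ₀ hT hδ₀T hδ₀reg τ' h1 tT htc
  exact twistedTubeJacobian_of_model L v hv ρG hρinj σ hσc hσ2 hσv hσne J hJ hJh hJ1 hJi1 hερ νGt hγ₀ hT (hsep _ hγ₀) rfl (Set.isClosed_centralizer ({(γ₀.val : GtLoc L v)} : Set (GtLoc L v)))
    (fun x hx => epsLoc_mem_centralizer_coe (Φ := splitFormGL L) γ₀ hx) (isClosed_epsCentralizer L (splitFormGL L) v δ₀) hP'A hP'ε τ' Ψ hΨ s hsm hsN R hRN tT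
    e.toMulEquiv e.continuous hev hpin Hmodel b₁ hb₁

end JacobianOfModel

end Summit.HodgeConjecture.HodgeConjecture.R90.S4

end
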